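import Mathlib.NumberTheory.LSeries.Deriv
import Literature.NumberTheory.Automorphic.JacquetShalikaEulerProducts
import Literature.NumberTheory.Automorphic.JacquetShalikaLargeFinsetProofs
import Literature.NumberTheory.Automorphic.SatakeParameterBoundHolds
import Literature.NumberTheory.Automorphic.PairLFunctionPolesChangeOfS
import HarnessLib

/-!
# `L^S(s, π ⊗ π̄)` is holomorphic and non-zero on `Re s > 1`, unconditionally

Topic `NumberTheory/Automorphic`; namespace `Literature.NumberTheory.Automorphic`. Proof file
(theorems only: no definition, no named fact, no instance). Jacquet–Shalika, *On Euler products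
and the classification of automorphic representations I*, Amer. J. Math. 103 (1981), Lemma (5.2)
(p. 554: "the function `L_S(s, π × π̄)` has an analytic continuation to the half plane
`Re(s) > 1`") and Thm. (5.3) with its proof (p. 556, (1)–(4): on that half-plane the Euler product
itself converges, equals `exp` of the Dirichlet series (5.3.3) with non-negative coefficients, and
"does not vanish"). In the tree, Lemma (5.2) is the named fact
`JacquetShalika1981_continuation_partialPairL_conj` (an *abstract* continuation `F`), discharged by
`JacquetShalika1981_continuation_partialPairL_conj_holds`; the convergence (5.3.3) for every `σ > 1`
is `summable_normSq_trace_satakePow_holds` and the bound (5.1.3) is `norm_satakeParameter_le_sqrt_holds`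
(`SatakeParameterBoundHolds`, through the real-point Rankin–Selberg method). This file draws the
consequence needed by the pole statement (2.3) of Arthur–Clozel in its real-moment form
(`PairLFunctionPolesRealMoments`, hypothesis "`L` holomorphic on `Re s > 1`"): the partial Euler
product `partialPairL S α (conjFamily α)` **itself** is holomorphic (and non-zero) on the whole open
half-plane `Re s > 1`, for every Satake family `α` of every cuspidal `Π ≤ L²_cusp(GL_n(𝔸_K))`.

* `partialPairL_conjFamily_eq_exp_LSeries_of_summable` — `L_S(s, α ⊗ ᾱ) = exp (∑_m a_m m^{-s})`
  at every `s` with `Re s > 1` at which (5.3.3) converges absolutely (the proof of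
  `partialPairL_conjFamily_eq_exp_LSeries` of `JacquetShalikaEulerProducts`, which had `Re s > 2`
  from (5.1.3) alone, run with the summability as input: the local expansions
  `log L(s, π_v × π̄_v) = ∑_k |tr A_v^k|² q_v^{-ks}/k` only need `|a ā'| q_v^{-σ} ≤ q_v^{1-σ} < 1`);
* `abscissaOfAbsConv_normSqTraceSeries_le_one_of_summable_jsCoeff` — (5.3.3) for all `σ > 1` says
  the abscissa of absolute convergence of `normSqTraceSeries S α` is `≤ 1` (restating
  `abscissaOfAbsConv_normSqTraceSeries_le_one_of_summable` of `JacquetShalikaLargeFinsetProofs`);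
* `differentiableOn_partialPairL_conjFamily_of_summable`, `partialPairL_conjFamily_ne_zero_of_summable`
  — hence `L_S(s, α ⊗ ᾱ)` is holomorphic and non-zero on `Re s > 1` (Mathlib
  `LSeries_differentiableOn`, `Complex.exp_ne_zero`);
* `differentiableOn_partialPairL_conjFamily`, `differentiableOn_partialPairL_conjFamily_left`,
  `partialPairL_conjFamily_ne_zero` — **unconditionally for Satake families of cuspidal
  representations** (inputs `summable_normSq_trace_satakePow_holds`, `norm_satakeParameter_le_sqrt_holds`),
  in both orders `α ⊗ ᾱ`, `ᾱ ⊗ α` (`partialPairL_comm`).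

## References

* H. Jacquet, J. A. Shalika, *On Euler products and the classification of automorphic
  representations I*, Amer. J. Math. 103 (1981), 499–558: Lemma (5.2) p. 554, Thm. (5.3),
  (5.3.3)–(5.3.4) and (1)–(4) p. 556. [JacquetShalikaAJM1981]
* J. Arthur, L. Clozel, *Simple algebras, base change, and the advanced theory of the trace
  formula*, Ann. of Math. Stud. 120 (1989), Ch. 3 §2, (2.1)–(2.3), p. 171. [ArthurClozelAMS120]
-/

noncomputable section

open scoped Topology ComplexConjugate
open NumberField IsDedekindDomain MeasureTheory Filter Complex

namespace Literature.NumberTheory.Automorphic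

/-! ### The Euler product as an exponential on `Re s > 1` -/

section Series

variable {K : Type} [Field K] [NumberField K]

/-- **`L_S(s, π × π̄) = exp f(s)` on `Re s > 1` wherever (5.3.3) converges absolutely**
(Jacquet–Shalika (1981), p. 556, (1)–(4)): under the local bound (5.1.3) `|μ_{j,v}| ≤ q_v^{1/2}`,
at every `s` with `Re s > 1` such that `∑_{v ∉ S} ∑_k |tr A_v^k|² q_v^{-k re s}/k < ∞`, the Euler
product `∏_{v ∉ S} det(1 - q_v^{-s} A_v ⊗ Ā_v)⁻¹ = partialPairL S α ᾱ s` converges and equals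
`exp (∑_m a_m m^{-s})`, `a = normSqTraceSeries S α`. Same proof as
`partialPairL_conjFamily_eq_exp_LSeries` (there for `Re s > 2`, where the summability is automatic).
[cite: JacquetShalikaAJM1981, Thm. (5.3), proof, (1)–(4) p. 556] -/
theorem partialPairL_conjFamily_eq_exp_LSeries_of_summable {S : Set (HeightOneSpectrum (𝓞 K))}
    {α : SatakeFamily K} (hb : ∀ v ∉ S, ∀ a ∈ α v, ‖a‖ ≤ Real.sqrt v.residueCard)
    {s : ℂ} (hs : 1 < s.re)
    (hsum : Summable fun i => jsCoeff S α i * (jsBase S i : ℝ) ^ (-s.re)) :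
    partialPairL S α (conjFamily α) s = Complex.exp (LSeries (normSqTraceSeries S α) s) := by
  -- the family over `ℕ × {v ∉ S}` is summable in `ℂ` and sums to `LSeries a s`
  have hsumC : Summable fun i : ℕ × {v : HeightOneSpectrum (𝓞 K) // v ∉ S} =>
      (jsCoeff S α i : ℂ) * (jsBase S i : ℂ) ^ (-s) :=
    summable_ofReal_mul_natCast_cpow (jsCoeff_nonneg S α) (jsBase_ne_zero S) hsum
  have hL : HasSum (fun i : ℕ × {v : HeightOneSpectrum (𝓞 K) // v ∉ S} =>
      (jsCoeff S α i : ℂ) * (jsBase S i : ℂ) ^ (-s)) (LSeries (normSqTraceSeries S α) s) := by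
    rw [normSqTraceSeries, LSeries_fiberCoeff_eq (jsBase_ne_zero S) hsumC]
    exact hsumC.hasSum
  -- sum first over `k`, for each `v ∉ S`
  set g : {v : HeightOneSpectrum (𝓞 K) // v ∉ S} → ℂ := fun v =>
    -((satakeTensor (α v.1) ((α v.1).map conj)).map fun c =>
      Complex.log (1 - c * ((v.1.residueCard : ℂ) ^ (-s)))).sum with hg
  have hx : ∀ v : {v : HeightOneSpectrum (𝓞 K) // v ∉ S},
      Real.sqrt v.1.residueCard * Real.sqrt v.1.residueCard * ‖(v.1.residueCard : ℂ) ^ (-s)‖ < 1 := by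
    intro v
    have hq1 : (1 : ℝ) < v.1.residueCard := by exact_mod_cast v.1.one_lt_residueCard
    have hq0 : (0 : ℝ) < v.1.residueCard := zero_lt_one.trans hq1
    rw [Real.mul_self_sqrt hq0.le, norm_natCast_cpow_of_pos (zero_lt_one.trans
      v.1.one_lt_residueCard), neg_re]
    calc (v.1.residueCard : ℝ) * (v.1.residueCard : ℝ) ^ (-s.re)
          = (v.1.residueCard : ℝ) ^ (1 + -s.re) := by rw [Real.rpow_add hq0, Real.rpow_one]
      _ < 1 := Real.rpow_lt_one_of_one_lt_of_neg hq1 (by linarith)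
  have hfib : ∀ v : {v : HeightOneSpectrum (𝓞 K) // v ∉ S},
      HasSum (fun k : ℕ => (jsCoeff S α (k, v) : ℂ) * (jsBase S (k, v) : ℂ) ^ (-s)) (g v) := by
    intro v
    have h := hasSum_normSq_powerSum_mul_pow_div (hb v.1 v.2) (hx v)
    refine (h.congr_fun fun k => ?_)
    rw [jsCoeff_mul_cpow_neg]
  have hG : HasSum g (LSeries (normSqTraceSeries S α) s) :=
    HasSum.prod_fiberwise
      ((Equiv.prodComm {v : HeightOneSpectrum (𝓞 K) // v ∉ S} ℕ).hasSum_iff.mpr hL) hfib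
  -- exponentiate
  have hP := hG.cexp
  have hfun : (cexp ∘ g) = fun v : {v : HeightOneSpectrum (𝓞 K) // v ∉ S} =>
      ((satakePairPolynomial (α v.1) (conjFamily α v.1)).eval ((v.1.residueCard : ℂ) ^ (-s)))⁻¹ := by
    funext v
    simp only [Function.comp_apply, hg, conjFamily_apply]
    exact exp_neg_sum_log_eq_inv_eval_satakePairPolynomial_conj (hb v.1 v.2) (hx v)
  rw [hfun] at hP
  exact hP.tprod_eq

/-- (5.3.3) for all `σ > 1`, in `jsCoeff`-currency, says `abscissaOfAbsConv (normSqTraceSeries S α) ≤ 1`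
(`abscissaOfAbsConv_normSqTraceSeries_le_one_of_summable` of `JacquetShalikaLargeFinsetProofs`,
whose hypothesis is the same family written out, `jsCoeff_mul_rpow_neg`). [folklore] -/
theorem abscissaOfAbsConv_normSqTraceSeries_le_one_of_summable_jsCoeff
    {S : Set (HeightOneSpectrum (𝓞 K))} {α : SatakeFamily K}
    (hsum : ∀ σ : ℝ, 1 < σ → Summable fun i => jsCoeff S α i * (jsBase S i : ℝ) ^ (-σ)) :
    LSeries.abscissaOfAbsConv (normSqTraceSeries S α) ≤ (1 : ℝ) :=
  abscissaOfAbsConv_normSqTraceSeries_le_one_of_summable fun σ hσ =>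
    (hsum σ hσ).congr fun i => jsCoeff_mul_rpow_neg S α σ i

/-- **`L_S(s, α ⊗ ᾱ)` is holomorphic on `Re s > 1`** under (5.1.3) and (5.3.3) for all `σ > 1`:
it is `exp ∘ LSeries a` there (`partialPairL_conjFamily_eq_exp_LSeries_of_summable`), and an
`L`-series is holomorphic on its open half-plane of absolute convergence (Mathlib
`LSeries_differentiableOn`). Jacquet–Shalika (1981), Lemma (5.2) with Thm. (5.3): here the Euler
product is its own continuation. [cite: JacquetShalikaAJM1981, Lemma (5.2) p. 554, Thm. (5.3)] -/
theorem differentiableOn_partialPairL_conjFamily_of_summable {S : Set (HeightOneSpectrum (𝓞 K))}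
    {α : SatakeFamily K} (hb : ∀ v ∉ S, ∀ a ∈ α v, ‖a‖ ≤ Real.sqrt v.residueCard)
    (hsum : ∀ σ : ℝ, 1 < σ → Summable fun i => jsCoeff S α i * (jsBase S i : ℝ) ^ (-σ)) :
    DifferentiableOn ℂ (partialPairL S α (conjFamily α)) {s : ℂ | 1 < s.re} := by
  have hd : DifferentiableOn ℂ (fun s => Complex.exp (LSeries (normSqTraceSeries S α) s))
      {s : ℂ | 1 < s.re} := by
    refine ((LSeries_differentiableOn _).mono fun s hs => ?_).cexp
    exact lt_of_le_of_lt (abscissaOfAbsConv_normSqTraceSeries_le_one_of_summable_jsCoeff hsum)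
      (by exact_mod_cast hs)
  exact hd.congr fun s hs => partialPairL_conjFamily_eq_exp_LSeries_of_summable hb hs (hsum _ hs)

/-- … and **non-zero** there ("In particular the function `L_S(s, π × π')` does not vanish for
`Re(s) > 1`", Jacquet–Shalika (1981), Thm. (5.3)). [cite: JacquetShalikaAJM1981, Thm. (5.3)] -/
theorem partialPairL_conjFamily_ne_zero_of_summable {S : Set (HeightOneSpectrum (𝓞 K))}
    {α : SatakeFamily K} (hb : ∀ v ∉ S, ∀ a ∈ α v, ‖a‖ ≤ Real.sqrt v.residueCard)
    {s : ℂ} (hs : 1 < s.re)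
    (hsum : Summable fun i => jsCoeff S α i * (jsBase S i : ℝ) ^ (-s.re)) :
    partialPairL S α (conjFamily α) s ≠ 0 := by
  rw [partialPairL_conjFamily_eq_exp_LSeries_of_summable hb hs hsum]
  exact Complex.exp_ne_zero _

end Series

/-! ### Unconditionally, for Satake families of cuspidal representations -/

section Cuspidal

variable {n : ℕ} {K : Type} [Field K] [NumberField K]
  {μ : Measure (AdelicGroupData.gl n K).automorphicQuotient}
  [(AdelicGroupData.gl n K).IsAutomorphicMeasure μ]

/-- (5.3.3) for a Satake family of a cuspidal `Π`, in the `jsCoeff`-currency of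
`JacquetShalikaEulerProducts` (`summable_normSq_trace_satakePow_holds`, `jsCoeff_mul_rpow_neg`).
[cite: JacquetShalikaAJM1981, Thm. (5.3), proof, (5.3.3)–(5.3.4) p. 556] -/
theorem summable_jsCoeff_mul_rpow_neg_of_isSatakeFamilyOf (P : CuspidalAutomorphicRepGL n K μ)
    {S : Set (HeightOneSpectrum (𝓞 K))} {α : SatakeFamily K} (hα : IsSatakeFamilyOf P S α)
    {σ : ℝ} (hσ : 1 < σ) :
    Summable fun i => jsCoeff S α i * (jsBase S i : ℝ) ^ (-σ) :=
  (summable_normSq_trace_satakePow_holds P hα hσ).congr fun i => (jsCoeff_mul_rpow_neg S α σ i).symm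

/-- **`L^S(s, π ⊗ π̄)` is holomorphic on `Re s > 1`, unconditionally**: for every cuspidal
automorphic representation `Π` of `GL_n(𝔸_K)` (in `L²_cusp`, hence unitary), every set `S` of finite
places and every Satake family `α` of `Π` off `S`, the partial Euler product
`partialPairL S α (conjFamily α)` is holomorphic on the open half-plane `Re s > 1`
(Jacquet–Shalika (1981), Lemma (5.2) and Thm. (5.3); inputs `summable_normSq_trace_satakePow_holds`,
`norm_satakeParameter_le_sqrt_holds`). [cite: JacquetShalikaAJM1981, Lemma (5.2) p. 554, Thm. (5.3)] -/
theorem differentiableOn_partialPairL_conjFamily (P : CuspidalAutomorphicRepGL n K μ)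
    {S : Set (HeightOneSpectrum (𝓞 K))} {α : SatakeFamily K} (hα : IsSatakeFamilyOf P S α) :
    DifferentiableOn ℂ (partialPairL S α (conjFamily α)) {s : ℂ | 1 < s.re} :=
  differentiableOn_partialPairL_conjFamily_of_summable
    (fun _ hv _ ha => norm_satakeParameter_le_sqrt_holds P hα hv ha)
    (fun _ hσ => summable_jsCoeff_mul_rpow_neg_of_isSatakeFamilyOf P hα hσ)

/-- The same in the order `L^S(s, π̄ ⊗ π) = partialPairL S (conjFamily α) α` of Arthur–Clozel's
(2.3) for the pair `(σ̄, σ)` (`partialPairL_comm`). [cite: JacquetShalikaAJM1981, Lemma (5.2), Thm. (5.3)] -/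
theorem differentiableOn_partialPairL_conjFamily_left (P : CuspidalAutomorphicRepGL n K μ)
    {S : Set (HeightOneSpectrum (𝓞 K))} {α : SatakeFamily K} (hα : IsSatakeFamilyOf P S α) :
    DifferentiableOn ℂ (partialPairL S (conjFamily α) α) {s : ℂ | 1 < s.re} := by
  rw [partialPairL_comm S (conjFamily α) α]
  exact differentiableOn_partialPairL_conjFamily P hα

/-- **`L^S(s, π ⊗ π̄) ≠ 0` for `Re s > 1`, unconditionally** (Jacquet–Shalika (1981), Thm. (5.3):
"In particular … does not vanish for `Re(s) > 1`"). [cite: JacquetShalikaAJM1981, Thm. (5.3)] -/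
theorem partialPairL_conjFamily_ne_zero (P : CuspidalAutomorphicRepGL n K μ)
    {S : Set (HeightOneSpectrum (𝓞 K))} {α : SatakeFamily K} (hα : IsSatakeFamilyOf P S α)
    {s : ℂ} (hs : 1 < s.re) : partialPairL S α (conjFamily α) s ≠ 0 :=
  partialPairL_conjFamily_ne_zero_of_summable
    (fun _ hv _ ha => norm_satakeParameter_le_sqrt_holds P hα hv ha) hs
    (summable_jsCoeff_mul_rpow_neg_of_isSatakeFamilyOf P hα hs)

/-- … and in the other order. [cite: JacquetShalikaAJM1981, Thm. (5.3)] -/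
theorem partialPairL_conjFamily_left_ne_zero (P : CuspidalAutomorphicRepGL n K μ)
    {S : Set (HeightOneSpectrum (𝓞 K))} {α : SatakeFamily K} (hα : IsSatakeFamilyOf P S α)
    {s : ℂ} (hs : 1 < s.re) : partialPairL S (conjFamily α) α s ≠ 0 := by
  rw [partialPairL_comm S (conjFamily α) α]
  exact partialPairL_conjFamily_ne_zero P hα hs

end Cuspidal

end Literature.NumberTheory.Automorphic
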